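import Summits.HodgeConjecture.CorCM.HypLiu418.RecordSystemToFrame
import Summits.HodgeConjecture.CorCM.HypLiu418.RecordSystemConjAlongConj
import Literature.AlgebraicGeometry.ShimuraVarieties.UnitaryShimuraRecordSystemUnique
import HarnessLib

/-!
# The off-place face: `V` re-read at the conjugate embedding, and the iso of the two CHOSEN model towers (modulo Milne Thm. 13.7)

Cell `hodgecm-mathlib`, fan A — `hLiu418` OFF PLACE, plan v1 FILE A (director g2 2026-08-28T04:40:51Z APPROVED; A-p08 lead, A-p02 FILE B,
A-p12 FILE C).  For the tree's hermitian 3-space `V : HermSpace3 F ι₁` (CorCM currency) at an embedding `ι₁`: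

* §1 **`HermSpace3.alongConj V : HermSpace3 F (conj ∘ ι₁)`** — the SAME Gram matrix `V.Hm` read at the conjugate embedding (signature witness
  `conjFrame (frameOf V)`, ✔ `formCongr_conjFrame_starRingEnd_comp`; positivity off the place is unchanged since `mk (conj ∘ ι₁) = mk ι₁`).  When `ι₁`
  is OFF place, `conj ∘ ι₁ = (mk ι₁).embedding` is AT place — the face at which the at-place junction ✔ `bettiThetaModelAtPlace_of_hyp413_of_pinning`
  applies (FILE B, A-p02: `embedding_mk_alongConj`).
* §2 **`recordOf_iso_alongConj_of_unique`** — for ANY Deligne record system `R₀` of `(V.Hm, conj ∘ ι₁)` below `K_f(3)` in ANY frame `T₀` (in the END: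
  the CHOSEN `recordOf h V.alongConj h4`, frame `frameOf V.alongConj`), an isomorphism of model towers `φ : (recordOf h V h4).M ≅ R₀.M` TOGETHER WITH
  its action on complex points: `φ_K` carries the twist `Spec(conj) ≫ (recordOf h V).pts_K⁻¹ [\overline{u • y}, aK]` to `R₀.pts_K⁻¹ [y, aK]`,
  `u = (conj T)⁻¹ T₀ ∈ U(2,1)` — from B2-as-data ✔ `RecordSystem.alongConj`, the frame move ✔ `RecordSystem.toFrame`, and A-p02's ✔
  `RecordSystem.nonempty_iso_of_canonicalModel_unique` (row I-4 `canonicalModel_unique_printed`, taken as the hypothesis `hU`).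
  This is A-p01's (3) `recordOf_conjTwist_iso` in the «same models, conjugate embedding» form; the points clause is what lets FILE D intertwine the
  HECKE translates of the two §4.2 data (pinned by points, ✔ `ComplexRecord.hecke_unique`).

KERNEL: one definition by explicit formula (`HermSpace3.alongConj`) + theorems; conditional on the named facts `h : exists_recordSystem` (row I-2, as
`recordOf`) and `hU : canonicalModel_unique_printed` (row I-4) taken as HYPOTHESES; no instance, no notation, no new named fact, no `sorry`.
HC_CM is NOT proved here; HC_CM is proved only modulo the 7 printed citations until rung 0 closes.

References: [Milne2005ShimuraVarieties] Thm. 13.7 (a) p. 119, §12, Lemma 5.13; [Deligne1979ShimuraVarieties] 2.2.5–2.2.6; [Liu2021] §4.2, Prop. C.5.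
-/

set_option autoImplicit false

noncomputable section

open CategoryTheory AlgebraicGeometry NumberField IsDedekindDomain Matrix
open Literature.AlgebraicGeometry.Motives
open Literature.NumberTheory.Automorphic.Liu2021.AppendixC (C5.OpenCompactSubgroup C5.SmallLevel)

namespace Summit.HodgeConjecture.CorCM

open scoped Matrix ComplexOrder
open Literature.AlgebraicGeometry.ShimuraVarieties Literature.AlgebraicGeometry.ShimuraVarieties.UnitaryCanonicalModel
open Literature.NumberTheory.Automorphic Literature.NumberTheory.Automorphic.UnitaryGroup
open Literature.NumberTheory.Automorphic.ShimuraDissection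
open Literature.Geometry.ComplexHyperbolic Literature.Geometry.ComplexHyperbolic.BallModel
open Summit.HodgeConjecture.CorCM.Model Summit.HodgeConjecture.CorCM.HComp
open Summit.HodgeConjecture.CorCM.Model.RecordSystemConj
open Summit.HodgeConjecture.CorCM.D2Bridge Summit.HodgeConjecture.CorCM.D2Bridge.UnitaryGroupConj

/-! ## §1 `V` read at the conjugate embedding -/

namespace HermSpace3

variable {F : CMField} {ι₁ : F →+* ℂ}

/-- `conj ∘ ι₁` is Mathlib's conjugate embedding `ComplexEmbedding.conjugate ι₁` (pointwise `rfl`). [folklore] -/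
theorem starRingEnd_comp_eq_conjugate (ι₁ : F →+* ℂ) : (starRingEnd ℂ).comp ι₁ = ComplexEmbedding.conjugate ι₁ :=
  RingHom.ext fun _ => rfl

/-- `conj ∘ ι₁` and `ι₁` define the same infinite place. [folklore] -/
theorem mk_starRingEnd_comp (ι₁ : F →+* ℂ) : InfinitePlace.mk ((starRingEnd ℂ).comp ι₁) = InfinitePlace.mk ι₁ := by
  rw [starRingEnd_comp_eq_conjugate, InfinitePlace.mk_conjugate_eq]

/-- **`V` read at the CONJUGATE embedding `conj ∘ ι₁`**: the SAME Gram matrix `V.Hm` (same hermitian space, same unitary group, same levels),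
of signature `(2,1)` at `conj ∘ ι₁` witnessed by the conjugate frame `conj (frameOf V)` (`(V.Hm)^{conj ∘ ι₁} = conj ((V.Hm)^{ι₁})`), positive
definite off the (common) place.  Off place, `conj ∘ ι₁ = (mk ι₁).embedding` is the AT-PLACE representative of the face. [folklore] -/
noncomputable def alongConj (V : HermSpace3 F ι₁) : HermSpace3 F ((starRingEnd ℂ).comp ι₁) where
  Hm := V.Hm
  isHermitian := V.isHermitian
  signature_ι₁ := ⟨conjFrame (Model.frameOf V), by
    have h := formCongr_conjFrame_starRingEnd_comp V.Hm ι₁ (Model.frameOf V) (Model.formCongr_frameOf V)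
    rw [formCongr_star] at h
    rw [UnitaryBallUniformisationDatum.signatureMatrix_two]
    exact h⟩
  posDef_of_ne τ hτ := V.posDef_of_ne τ (by rwa [mk_starRingEnd_comp] at hτ)

/-- (definitional) `V.alongConj.Hm = V.Hm`. [folklore] -/
@[simp] theorem alongConj_Hm (V : HermSpace3 F ι₁) : V.alongConj.Hm = V.Hm :=
  rfl

/-- Positivity of `V.Hm` off the place of `conj ∘ ι₁` (= the place of `ι₁`) — the hypothesis `hpos` of rows I-2 / I-4 at the conjugate
embedding. [folklore] -/
theorem posDef_of_ne_starRingEnd_comp (V : HermSpace3 F ι₁) :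
    ∀ τ' : F →+* ℂ, InfinitePlace.mk τ' ≠ InfinitePlace.mk ((starRingEnd ℂ).comp ι₁) → (V.Hm.map τ').PosDef :=
  fun τ' hτ' => V.posDef_of_ne τ' (by rwa [mk_starRingEnd_comp] at hτ')

end HermSpace3

/-! ## §2 The two CHOSEN model towers are isomorphic, compatibly with points (modulo Milne Thm. 13.7) -/

namespace Model.RecordSystemConj

variable {F : CMField} {ι₁ : F →+* ℂ}

set_option maxHeartbeats 400000 in
/-- **The off-place tower isomorphism.**  Let `V : HermSpace3 F ι₁`, `4 ≤ [F:ℚ]`, `R := recordOf h V h4` (Deligne's CHOSEN models of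
`Sh(U(V), 𝔹²)` along `ι₁`, frame `T := frameOf V`, below `K_f(3)`) and let `R₀` be ANY record system of the SAME space `V.Hm` below the SAME
`K_f(3)` read at the CONJUGATE embedding `conj ∘ ι₁` in a frame `T₀`.  Modulo the printed uniqueness of canonical models (`hU`, [Milne2005ShimuraVarieties]
Thm. 13.7 (a)) there is an isomorphism of model towers `φ : R.M ≅ R₀.M` over `F` such that, on complex points along `conj ∘ ι₁`,
`φ_K (Spec(conj) ≫ R.pts_K⁻¹ [\overline{u • y}, aK]) = R₀.pts_K⁻¹ [y, aK]` with `u := frameRatio (conj T) T₀ = (conj T)⁻¹ T₀ ∈ U(2,1)` — read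
through `(M_K(ℂ) ≃ (M_K)_{conj∘ι₁}(ℂ))` (`AlgPoints.baseChangeEquiv`).  Proof: `R` re-read at `(conj ∘ ι₁, conj T)` with the same models (B2,
✔ `RecordSystem.alongConj`, points = twists of the points at the conjugate ball point), moved to the frame `T₀` (✔ `RecordSystem.toFrame`, points
`y ↦ u • y`), is — like `R₀` — a record system of the datum `(V.Hm, conj ∘ ι₁, T₀, K_f(3))`; A-p02's ✔ `RecordSystem.nonempty_iso_of_canonicalModel_unique`.
[cite: Milne2005ShimuraVarieties, Thm. 13.7 (a) p. 119; §12; Lemma 5.13 p. 57] [cite: Deligne1979ShimuraVarieties, 2.2.5–2.2.6] -/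
theorem recordOf_iso_alongConj_of_unique (hU : canonicalModel_unique_printed) (h : exists_recordSystem) (V : HermSpace3 F ι₁)
    (h4 : 4 ≤ Module.finrank ℚ F) {T₀ : GL (Fin 3) ℂ}
    (hT₀ : formCongr (starRingEnd ℂ) T₀ (V.Hm.map ((starRingEnd ℂ).comp ι₁)) = BallModel.J)
    (R₀ : RecordSystem F V.Hm ((starRingEnd ℂ).comp ι₁) T₀ hT₀ (K3 V)) :
    ∃ φ : (recordOf h V h4).M ≅ R₀.M,
      letI : Algebra (F : Type) ℂ := ((starRingEnd ℂ).comp ι₁).toAlgebra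
      ∀ (K : C5.SmallLevel (K3 V)) (y : Ball) (a : V.adelicFin),
        (AlgPoints.baseChangeEquiv ((starRingEnd ℂ).comp ι₁) (R₀.M.obj K)).symm
            (AlgPoints.map ((baseChangeHom ((starRingEnd ℂ).comp ι₁)).map (φ.hom.app K))
              (AlgPoints.baseChangeEquiv ((starRingEnd ℂ).comp ι₁) ((recordOf h V h4).M.obj K)
                (twist (conjEmb_eq ι₁) (letI : Algebra (F : Type) ℂ := ι₁.toAlgebra
                  ((recordOf h V h4).pts K).symm (ShimuraSet.mk F V.Hm ι₁ (frameOf V) (formCongr_frameOf V) K.1.1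
                    (conjBall (frameRatio F V.Hm ((starRingEnd ℂ).comp ι₁) (conjFrame (frameOf V)) T₀
                      (formCongr_conjFrame_starRingEnd_comp V.Hm ι₁ (frameOf V) (formCongr_frameOf V)) hT₀ • y)) a))))) =
          (R₀.pts K).symm (ShimuraSet.mk F V.Hm ((starRingEnd ℂ).comp ι₁) T₀ hT₀ K.1.1 y a) := by
  letI : Algebra (F : Type) ℂ := ((starRingEnd ℂ).comp ι₁).toAlgebra
  -- `R` re-read at `(conj ∘ ι₁, conj T)` (B2), then moved to the frame `T₀`: a record system of the datum of `R₀`, models `R.M`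
  let S : RecordSystem F V.Hm ((starRingEnd ℂ).comp ι₁) T₀ hT₀ (K3 V) :=
    RecordSystem.toFrame T₀ hT₀ (RecordSystem.alongConj (recordOf h V h4))
  obtain ⟨φ, hφ⟩ := RecordSystem.nonempty_iso_of_canonicalModel_unique hU (HermSpace3.posDef_of_ne_starRingEnd_comp V)
    (HermSpace3.anisotropic_of_four_le V h4) (torsionFree_arithmeticLevel_conj_K3 V) S R₀
  refine ⟨φ, fun K y a => ?_⟩
  have key := hφ K (ShimuraSet.mk F V.Hm ((starRingEnd ℂ).comp ι₁) T₀ hT₀ K.1.1 y a)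
  rw [show (S.pts K).symm (ShimuraSet.mk F V.Hm ((starRingEnd ℂ).comp ι₁) T₀ hT₀ K.1.1 y a) = _ from
    RecordSystem.toFrame_pts_symm_mk T₀ hT₀ (RecordSystem.alongConj (recordOf h V h4)) K y a,
    RecordSystem.alongConj_pts_symm_mk] at key
  exact key

/-- **The same for the two CHOSEN towers of the two faces** `(ι₁, V)` and `(conj ∘ ι₁, V.alongConj)`: `φ : (recordOf h V h4).M ≅ (recordOf h V.alongConj h4).M`
(frames `frameOf V`, `frameOf V.alongConj`; `V.alongConj.Hm = V.Hm` and `K3 V.alongConj = K3 V` definitionally). [cite: Milne2005ShimuraVarieties, Thm. 13.7 (a) p. 119]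
[cite: Deligne1979ShimuraVarieties, 2.2.5–2.2.6] -/
theorem recordOf_iso_recordOf_alongConj_of_unique (hU : canonicalModel_unique_printed) (h : exists_recordSystem) (V : HermSpace3 F ι₁)
    (h4 : 4 ≤ Module.finrank ℚ F) :
    ∃ φ : (recordOf h V h4).M ≅ (recordOf h V.alongConj h4).M,
      letI : Algebra (F : Type) ℂ := ((starRingEnd ℂ).comp ι₁).toAlgebra
      ∀ (K : C5.SmallLevel (K3 V)) (y : Ball) (a : V.adelicFin),
        (AlgPoints.baseChangeEquiv ((starRingEnd ℂ).comp ι₁) ((recordOf h V.alongConj h4).M.obj K)).symm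
            (AlgPoints.map ((baseChangeHom ((starRingEnd ℂ).comp ι₁)).map (φ.hom.app K))
              (AlgPoints.baseChangeEquiv ((starRingEnd ℂ).comp ι₁) ((recordOf h V h4).M.obj K)
                (twist (conjEmb_eq ι₁) (letI : Algebra (F : Type) ℂ := ι₁.toAlgebra
                  ((recordOf h V h4).pts K).symm (ShimuraSet.mk F V.Hm ι₁ (frameOf V) (formCongr_frameOf V) K.1.1
                    (conjBall (frameRatio F V.Hm ((starRingEnd ℂ).comp ι₁) (conjFrame (frameOf V)) (frameOf V.alongConj)
                      (formCongr_conjFrame_starRingEnd_comp V.Hm ι₁ (frameOf V) (formCongr_frameOf V)) (formCongr_frameOf V.alongConj) • y))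
                    a))))) =
          ((recordOf h V.alongConj h4).pts K).symm
            (ShimuraSet.mk F V.Hm ((starRingEnd ℂ).comp ι₁) (frameOf V.alongConj) (formCongr_frameOf V.alongConj) K.1.1 y a) :=
  recordOf_iso_alongConj_of_unique hU h V h4 (formCongr_frameOf V.alongConj) (recordOf h V.alongConj h4)

end Model.RecordSystemConj

end Summit.HodgeConjecture.CorCM

end
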